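/-
Copyright: statement-level skeleton of a published paper (lit-balaban cell, Phase-2 proof seat p37 gen 105). No claims beyond
what the kernel checks below.
-/
import Literature.MathematicalPhysics.QuantumFieldTheory.Balaban1983to89.B3OnePIGraphs

/-!
# B3 — T. Bałaban, *(Higgs)₂,₃ quantum fields in a finite volume. III. Renormalization*, CMP **88** (1983) 411–445
[Balaban1983Higgs3] — p. 416 [PDF 6] (1.21): the graph-theoretic BRIDGE LEMMA behind the chain structure
«G^ε = Σ_n C₀^ε[X C₀^ε]ⁿ, X = −δm² + (amputated one-particle-irreducible graphs)» on the concrete graph model `B3Cor23Concrete.Graph`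
(p18): in a connected graph, an internal line whose cut separates two vertices is NOT a loop, has exactly one endpoint on each
side, every other line stays inside a side, and the two sides exhaust the vertices — so cutting a separating line leaves exactly
two connected pieces (the step that, iterated over the separating lines of a connected two-leg graph, yields its chain of proper
pieces); corollaries: loops and doubled lines never separate

statement-level skeleton of published theorems with citation tags; proofs where landed; nothing here is a claim about
the Yang–Mills mass gap

PDF held: `paper:balaban1983-higgs-2-3-quantum-fields-finite-volume` (journal page = PDF page + 410); pp. 415–417 read in the text
layer (`p0005.txt`–`p0007.txt` of `lit read`) and on the ×2 renders `run/shared/lean/pub/pub-balaban/b2b-balaban-ref1/pages/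
1983-cmp88-higgs23-III/1983-cmp88-higgs23-III-p005, p006, p007-x2.png`.

CITATION HEADER (lean-in-tree rule).  lit-balaban TYPED SKELETON (HOME `run/shared/lean/pub/lit-balaban/`), PHASE 2, seat p37
gen 105 (unit `lit-balaban-p37`), third file of BRICK 3 of the owner r15's HQ25 programme for row **B3.Eq1.19-1.22** (fold owner
r15; lead g12 HEAD WORD Q25 2026-08-23T08:24:18Z: the `B3TwoPointPerturbativeExpansion` bricks are WELCOME located members, zero head
weight).  Sibling of `B3OnePIGraphs` (`IsConnected`, `IsOnePI`, `IsProper`, `Adj`, `AdjOff`) and `B3OnePIPictureCensus`.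
p32 g41's BRICK 2 `B3Eq121OnePIChains` indexes the connected two-leg graphs as CHAINS of 1PI insertions abstractly and names the
graph-theoretic decomposition *"not derived on `B3Cor23Concrete.Graph`"*; this file proves its one-line core on the model.
REUSED BY NAME, nothing re-declared: p18's `B3Cor23Concrete.Graph`/`Leg` (`other_symm`, `other_ne`), `B3OnePIGraphs.Adj`/`AdjOff`/
`IsConnected`/`IsConnectedOff`/`adj_symm`/`adjOff_symm`/`reflTransGen_adjOff_symm`.

THE PRINTED TEXT (verbatim).  p. 416: *"The function G^ε has a perturbative expansion of the following structure
G^ε = Σ_{n=0}^∞ C₀^ε[(−δm² + Σ^ε + ∂^{ε*}Σ₁^ε + Σ₁^{ε*}∂^ε + ∂^{ε*}Σ₂^ε∂^ε)C₀^ε]ⁿ, (1.21) where C₀^ε = (−Δ₀^ε + m²)^{−1} and Σ^ε, Σ₁^ε, Σ₂^ε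
are given by amputated, one-particle-irreducible graphs of the expansion of G^ε."*  p. 415: *"a graph for us is a collection of
internal lines, external legs, and vertices connected in the usual sense. There is at least one internal line, and every internal
line has a vertex at each endpoint."*  (Print states the chain structure without proof — the standard combinatorics of formal
perturbation theory; what is proved here is the textbook bridge lemma it rests on, for the model's graphs.)

WHAT IS PROVED (theorems only; no definition, no `Prop` fact, no `sorry`; standard axioms).  For a graph `G` of the
model, a leg `c` on an internal line ℓ = {c, c′} (`G.other c = some c′`) and, for a vertex `i`, "the side of `i`" = the vertices joined
to `i` after cutting ℓ (`ReflTransGen (AdjOff G c) i ·`):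
* `isEndpoint_iff` (the endpoints of ℓ are c.1 and c′.1) and `adj_cases`: an adjacency of `G` either survives the cut of ℓ or
  joins the two endpoints of ℓ; `reach_cases`: a path of `G` from `v` to `w` either survives the cut or brings `v` to an endpoint of ℓ without
  using ℓ (the "first use of ℓ" argument);
* for `G` connected and ℓ SEPARATING `i` from `j` (`¬ ReflTransGen (AdjOff G c) i j`): **`exists_endpoint_inside`** /
  **`exists_endpoint_outside`** (ℓ has an endpoint on the side of `i` and an endpoint joined to `j` off the side of `i`),
  **`fst_ne_of_separates`** (ℓ is NOT a loop: c.1 ≠ c′.1), **`sides_of_separates`** (exactly one endpoint of ℓ on each side),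
  **`side_total`** (every vertex lies on the side of `i` or on the side of `j`: the cut leaves exactly two pieces),
  **`other_line_same_side`** (every internal line other than ℓ has both endpoints on the same side — ℓ is the unique crossing);
* corollaries: **`isConnectedOff_of_loop`** (cutting a loop never disconnects a connected graph), **`isConnectedOff_of_parallel`**
  (cutting a line that is doubled by another line between the same two vertices never disconnects) — the mechanism by which the
  pictures ④⑤⑥ of (1.22) and ⑦ (every line on a cycle) are 1PI, while a single line between two parts is a bridge (`B3OnePIPictureCensus`).
HONEST SCOPE.  The iteration of the lemma over all separating lines of a connected two-leg graph (the chain of proper pieces, their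
linear order along the channel, the sub-graphs as objects) is NOT constructed here; nothing analytic.
-/

namespace Literature.MathematicalPhysics.QuantumFieldTheory.Balaban1983to89.B3OnePIBridge

open Relation B3Prop1 B3Cor23Concrete B3OnePIGraphs

variable {nbar : ℕ} {G : Graph nbar}

/-! ## §1 Endpoints of a line; how a path meets a cut line -/

/-- kernel: "`v` is an endpoint of the internal line through the leg `c`" is written `v = c.1 ∨ (G.other c).map Sigma.fst = some v`
(the vertex of `c`, or the vertex of the other leg); with `G.other c = some c′` the endpoints are `c.1` and `c′.1` (for a loop the
two coincide). [cite: Balaban1983Higgs3, p.415] -/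
theorem isEndpoint_iff {c c' : Leg G.kind} (hc : G.other c = some c') {v : Fin G.nV} :
    (v = c.1 ∨ (G.other c).map Sigma.fst = some v) ↔ v = c.1 ∨ v = c'.1 := by
  rw [hc]
  simp [eq_comm]

/-- kernel: an adjacency of `G` either survives the cut of the line through `c`, or it IS that line — then both vertices are its
endpoints. [cite: Balaban1983Higgs3, (1.21) p.416] -/
theorem adj_cases {c : Leg G.kind} {u v : Fin G.nV} (h : Adj G u v) :
    AdjOff G c u v ∨
      ((u = c.1 ∨ (G.other c).map Sigma.fst = some u) ∧ (v = c.1 ∨ (G.other c).map Sigma.fst = some v)) := by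
  obtain ⟨x, y, hxy, hx, hy⟩ := adj_iff.1 h
  by_cases hxc : x = c
  · subst hxc
    exact Or.inr ⟨Or.inl hx.symm, Or.inr (by simp [hxy, hy])⟩
  by_cases hyc : y = c
  · subst hyc
    have hcx : G.other y = some x := G.other_symm _ _ hxy
    exact Or.inr ⟨Or.inr (by simp [hcx, hx]), Or.inl hy.symm⟩
  exact Or.inl (adjOffOf_iff.2 ⟨x, y, hxy, hxc, hyc, hx, hy⟩)

/-- kernel ("first use of the line"): a path of `G` from `v` to `w` either avoids the line through `c` altogether, or it brings `v`
to an endpoint of that line without using it. [cite: Balaban1983Higgs3, (1.21) p.416] -/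
theorem reach_cases {c : Leg G.kind} {v w : Fin G.nV} (h : ReflTransGen (Adj G) v w) :
    ReflTransGen (AdjOff G c) v w ∨
      ∃ e, (e = c.1 ∨ (G.other c).map Sigma.fst = some e) ∧ ReflTransGen (AdjOff G c) v e := by
  induction h with
  | refl => exact Or.inl ReflTransGen.refl
  | tail _ huw ih =>
      rcases ih with hvu | ⟨e, he, hve⟩
      · rcases adj_cases huw with h' | ⟨hu, _⟩
        · exact Or.inl (hvu.tail h')
        · exact Or.inr ⟨_, hu, hvu⟩
      · exact Or.inr ⟨e, he, hve⟩

/-! ## §2 A separating line of a connected graph is a bridge -/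

section Bridge

variable (hG : IsConnected G) {c c' : Leg G.kind} (hc : G.other c = some c') {i j : Fin G.nV}
  (hsep : ¬ ReflTransGen (AdjOff G c) i j)
include hG hsep

/-- **an endpoint on the near side**: if cutting the line ℓ through `c` separates `i` from `j` in a connected graph, some endpoint of
ℓ is still joined to `i` after the cut. [cite: Balaban1983Higgs3, (1.21) p.416] -/
theorem exists_endpoint_inside :
    ∃ e, (e = c.1 ∨ (G.other c).map Sigma.fst = some e) ∧ ReflTransGen (AdjOff G c) i e := by
  rcases reach_cases (c := c) (hG i j) with h | h
  · exact absurd h hsep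
  · exact h

/-- **an endpoint on the far side**: … and some endpoint of ℓ is still joined to `j` after the cut (hence not to `i`).
[cite: Balaban1983Higgs3, (1.21) p.416] -/
theorem exists_endpoint_outside :
    ∃ e, (e = c.1 ∨ (G.other c).map Sigma.fst = some e) ∧ ReflTransGen (AdjOff G c) e j ∧
      ¬ ReflTransGen (AdjOff G c) i e := by
  rcases reach_cases (c := c) (hG j i) with h | ⟨e, he, hje⟩
  · exact absurd (reflTransGen_adjOff_symm h) hsep
  · refine ⟨e, he, reflTransGen_adjOff_symm hje, fun hie => hsep (hie.trans (reflTransGen_adjOff_symm hje))⟩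

include hc

/-- **a separating line is not a loop**: its two legs sit at different vertices. [cite: Balaban1983Higgs3, (1.21) p.416] -/
theorem fst_ne_of_separates : c.1 ≠ c'.1 := by
  obtain ⟨e₁, he₁, h₁⟩ := exists_endpoint_inside hG hsep
  obtain ⟨e₂, he₂, -, h₂⟩ := exists_endpoint_outside hG hsep
  rw [isEndpoint_iff hc] at he₁ he₂
  intro heq
  have : e₁ = e₂ := by
    rcases he₁ with rfl | rfl <;> rcases he₂ with rfl | rfl <;> simp [heq]
  exact h₂ (this ▸ h₁)

/-- **exactly one endpoint on each side**: either `c.1` is joined to `i` and `c′.1` to `j` after the cut (and not to `i`), or the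
other way round. [cite: Balaban1983Higgs3, (1.21) p.416] -/
theorem sides_of_separates :
    (ReflTransGen (AdjOff G c) i c.1 ∧ ReflTransGen (AdjOff G c) c'.1 j ∧ ¬ ReflTransGen (AdjOff G c) i c'.1) ∨
    (ReflTransGen (AdjOff G c) i c'.1 ∧ ReflTransGen (AdjOff G c) c.1 j ∧ ¬ ReflTransGen (AdjOff G c) i c.1) := by
  obtain ⟨e₁, he₁, h₁⟩ := exists_endpoint_inside hG hsep
  obtain ⟨e₂, he₂, h₂, h₂'⟩ := exists_endpoint_outside hG hsep
  rw [isEndpoint_iff hc] at he₁ he₂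
  rcases he₁ with rfl | rfl <;> rcases he₂ with rfl | rfl
  · exact absurd h₁ h₂'
  · exact Or.inl ⟨h₁, h₂, h₂'⟩
  · exact Or.inr ⟨h₁, h₂, h₂'⟩
  · exact absurd h₁ h₂'

/-- **the cut leaves exactly two pieces**: every vertex is joined, after the cut, either to `i` or to `j` (and not to both, by
`hsep`). [cite: Balaban1983Higgs3, (1.21) p.416] -/
theorem side_total (v : Fin G.nV) : ReflTransGen (AdjOff G c) i v ∨ ReflTransGen (AdjOff G c) v j := by
  rcases reach_cases (c := c) (hG v i) with h | ⟨e, he, hve⟩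
  · exact Or.inl (reflTransGen_adjOff_symm h)
  · by_cases hie : ReflTransGen (AdjOff G c) i e
    · exact Or.inl (hie.trans (reflTransGen_adjOff_symm hve))
    · right
      rw [isEndpoint_iff hc] at he
      rcases sides_of_separates hG hc hsep with ⟨h₁, h₂, _⟩ | ⟨h₁, h₂, _⟩
      · rcases he with rfl | rfl
        · exact absurd h₁ hie
        · exact hve.trans h₂
      · rcases he with rfl | rfl
        · exact hve.trans h₂
        · exact absurd h₁ hie

end Bridge

/-- **the separating line is the unique crossing**: every internal line other than ℓ = {c, c′} has both endpoints on the same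
side of any cut of ℓ (its endpoints stay adjacent after the cut). [cite: Balaban1983Higgs3, (1.21) p.416] -/
theorem other_line_same_side {c c' : Leg G.kind} (hc : G.other c = some c') {i : Fin G.nV} {x y : Leg G.kind}
    (hxy : G.other x = some y) (hx : x ≠ c) (hx' : x ≠ c') :
    ReflTransGen (AdjOff G c) i x.1 ↔ ReflTransGen (AdjOff G c) i y.1 := by
  have hyc : y ≠ c := by
    rintro rfl
    have := G.other_symm _ _ hxy
    rw [hc] at this
    exact hx' (Option.some.inj this).symm
  have hadj : AdjOff G c x.1 y.1 := adjOffOf_iff.2 ⟨x, y, hxy, hx, hyc, rfl, rfl⟩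
  exact ⟨fun h => h.tail hadj, fun h => h.tail (adjOff_symm hadj)⟩

/-! ## §3 Corollaries: loops and doubled lines never separate -/

/-- **cutting a loop never disconnects**: if the line through `c` returns to its own vertex, a connected graph stays connected
after cutting it. [cite: Balaban1983Higgs3, (1.21) p.416] -/
theorem isConnectedOff_of_loop (hG : IsConnected G) {c c' : Leg G.kind} (hc : G.other c = some c') (hloop : c.1 = c'.1) :
    IsConnectedOff G c := by
  intro i j
  by_contra hsep
  exact fst_ne_of_separates hG hc hsep hloop

/-- **cutting a doubled line never disconnects**: if besides ℓ = {c, c′} a second internal line {x, y} joins the same two vertices,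
a connected graph stays connected after cutting ℓ (the mechanism behind the 1PI pictures ④⑤⑥ of (1.22)).
[cite: Balaban1983Higgs3, (1.21) p.416] -/
theorem isConnectedOff_of_parallel (hG : IsConnected G) {c c' x y : Leg G.kind} (hc : G.other c = some c')
    (hxy : G.other x = some y) (hx : x ≠ c) (hx' : x ≠ c') (hends : x.1 = c.1 ∧ y.1 = c'.1 ∨ x.1 = c'.1 ∧ y.1 = c.1) :
    IsConnectedOff G c := by
  intro i j
  by_contra hsep
  have hside := other_line_same_side hc (i := i) hxy hx hx'
  rcases sides_of_separates hG hc hsep with ⟨h₁, -, h₃⟩ | ⟨h₁, -, h₃⟩ <;> rcases hends with ⟨ex, ey⟩ | ⟨ex, ey⟩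
  · exact h₃ (ey ▸ hside.1 (ex ▸ h₁))
  · exact h₃ (ex ▸ hside.2 (ey ▸ h₁))
  · exact h₃ (ex ▸ hside.2 (ey ▸ h₁))
  · exact h₃ (ey ▸ hside.1 (ex ▸ h₁))

/-- kernel: a connected graph in which every internal line is a loop or is doubled is one-particle-irreducible.
[cite: Balaban1983Higgs3, (1.21) p.416] -/
theorem isOnePI_of_loops_or_parallels (hG : IsConnected G)
    (h : ∀ c c' : Leg G.kind, G.other c = some c' →
      c.1 = c'.1 ∨ ∃ x y : Leg G.kind, G.other x = some y ∧ x ≠ c ∧ x ≠ c' ∧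
        (x.1 = c.1 ∧ y.1 = c'.1 ∨ x.1 = c'.1 ∧ y.1 = c.1)) :
    IsOnePI G := by
  refine ⟨hG, fun c hcs => ?_⟩
  obtain ⟨c', hc⟩ := Option.isSome_iff_exists.1 hcs
  rcases h c c' hc with hloop | ⟨x, y, hxy, hx, hx', hends⟩
  · exact isConnectedOff_of_loop hG hc hloop
  · exact isConnectedOff_of_parallel hG hc hxy hx hx' hends

end Literature.MathematicalPhysics.QuantumFieldTheory.Balaban1983to89.B3OnePIBridge
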